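import Literature.NumberTheory.Automorphic.CornerRankGL
import HarnessLib

/-!
# The double cosets `P_c \ GL_n(K) / P_{c'}` of two standard parabolic subgroups

Second structural input of the Geometrical Lemma for `GL_n` (Bernstein–Zelevinsky 1977, Lemma 2.11
and 2.12; Casselman 1995, §1.3, §6.3): the double cosets `C(x) = P_c x P_{c'}` of two standard
parabolic subgroups of `GL_n(K)` (`c : Fin n → α`, `c' : Fin n → β` monotone block labellings) are

* represented by permutation matrices (`exists_mem_doubleCoset_permGL`, from the Bruhat
  decomposition `GL_n = ⋃_σ P_c P_σ U` of `BruhatDecompositionGL` and `U ≤ P_{c'}`);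
* **classified by the corner ranks** of `CornerRankGL`: the `(P_c, P_{c'})`-double coset of the
  permutation matrix `P_σ` is exactly the fibre `{g | ρ_{k,l}(g) = ρ_{k,l}(P_σ) for all k, l}` of
  the corner-rank vector (`doubleCoset_permGL_eq_cornerRankFibre`), where
  `ρ_{k,l}(P_σ) = #{i | k ≤ c i, c' (σ i) ≤ l}` (`cornerRank_permGL`);
* hence any two double cosets coincide or are disjoint, the double cosets are finite in number
  (indexed by the values of the corner-rank vector), and — by `CornerRankGL` — each is relatively
  open and relatively closed in the (bi-invariant) level set of the total corner rank, the level
  sets being the differences of the decreasing family of open sets `{|ρ| ≥ m}`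
  (`exists_isOpen_doubleCoset_eq_inter`, `exists_isClosed_doubleCoset_eq_inter`). This is the
  geometric statement consumed by Casselman 1995, Prop. 6.3.1 ("`G_w` is open", "`C(x)` is closed
  in `G_R` for `x` minimal").

The combinatorial heart (`exists_perm_eq_of_cellCount_eq`): if two permutations `σ`, `τ` have the
same **cell counts** `#{i | c i = a, c' (σ i) = b}` for all blocks `(a, b)` — which follows from
the equality of the cumulative corner counts by a double differencing
(`cellCount_eq_of_cornerCount_eq`) — then `τ = w' σ w` with `w` preserving the `c`-blocks and `w'`
preserving the `c'`-blocks (`Equiv.ofFiberEquiv` on the fibres of `i ↦ (c i, c' (σ i))`), whence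
`P_τ = P_w P_σ P_{w'} ∈ P_c P_σ P_{c'}`. This is Bernstein–Zelevinsky's Lemma 2.11 (a) for
`GL_n` (each double class `W_N \ W / W_M` has a distinguished representative) in the form needed
here. One definition (`doubleCoset`), theorems otherwise; no named facts.

## References

* I. N. Bernstein, A. V. Zelevinsky, *Induced representations of reductive `p`-adic groups I*,
  Ann. Sci. ÉNS (4) 10 (1977), 1.5, Lemma 2.11, 2.12, pp. 444, 448. [BernsteinZelevinsky1977]
* W. Casselman, *Introduction to the theory of admissible representations of `p`-adic reductive
  groups* (draft 1 May 1995), Prop. 1.3.1, §6.3 p. 55. [Casselman1995]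
-/

noncomputable section

open scoped MatrixGroups
open Matrix

namespace Literature.NumberTheory.Automorphic

section Counts

variable {K : Type*} [Field K] {n : ℕ} {α β : Type*} [LinearOrder α] [LinearOrder β]
  (c : Fin n → α) (c' : Fin n → β)

/-! ### Corner ranks of permutation matrices -/

/-- **The rank of a corner of a permutation matrix is the number of its ones**: for row and column
predicates `P`, `Q`, the submatrix of `P_σ` (`(P_σ)_{ij} = [σ i = j]`) on `{P} × {Q}` has rank
`#{i | P i ∧ Q (σ i)}` (its non-zero columns are distinct standard basis vectors). [folklore] -/
theorem rank_submatrix_permMatrix (σ : Equiv.Perm (Fin n)) (P Q : Fin n → Prop)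
    [DecidablePred P] [DecidablePred Q] :
    ((σ.permMatrix K).submatrix (Subtype.val : {i // P i} → Fin n)
        (Subtype.val : {j // Q j} → Fin n)).rank =
      (Finset.univ.filter fun i : Fin n => P i ∧ Q (σ i)).card := by
  classical
  set R := {i : Fin n // P i}
  set S : Matrix R {j : Fin n // Q j} K :=
    (σ.permMatrix K).submatrix (Subtype.val : R → Fin n) (Subtype.val : {j // Q j} → Fin n) with hS
  set T := {i : R // Q (σ (i : Fin n))}
  set b : T → (R → K) := fun t => Pi.single (t : R) 1 with hb
  have hli : LinearIndependent K b := by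
    have := (Pi.basisFun K R).linearIndependent.comp (fun t : T => (t : R)) Subtype.val_injective
    convert this using 1
    funext t
    simp [hb, Function.comp, Pi.basisFun_apply]
  have hScol : ∀ (k : {j // Q j}) (i : R), S.col k i = if σ i = k then 1 else 0 :=
    fun k i => by simp [Matrix.col, hS]
  have hST : Submodule.span K (Set.range S.col) = Submodule.span K (Set.range b) := by
    apply le_antisymm
    · rw [Submodule.span_le]
      rintro _ ⟨k, rfl⟩
      by_cases h : P (σ.symm (k : Fin n))
      · have ht : Q (σ ((⟨σ.symm k, h⟩ : R) : Fin n)) := by simpa using k.2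
        have : S.col k = b ⟨⟨σ.symm k, h⟩, ht⟩ := by
          ext i
          have hiff : (σ (i : Fin n) = (k : Fin n)) ↔ i = ⟨σ.symm k, h⟩ := by
            rw [Subtype.ext_iff]
            exact (Equiv.eq_symm_apply σ).symm
          simp only [hScol, hb, Pi.single_apply]
          by_cases hi : σ (i : Fin n) = (k : Fin n)
          · rw [if_pos hi, if_pos (hiff.1 hi)]
          · rw [if_neg hi, if_neg (fun h' => hi (hiff.2 h'))]
        rw [this]
        exact Submodule.subset_span ⟨_, rfl⟩
      · have : S.col k = 0 := by
          ext i
          rw [hScol, Pi.zero_apply, ite_eq_right_iff]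
          intro hik
          exfalso
          apply h
          rw [← hik, Equiv.symm_apply_apply]
          exact i.2
        rw [this]
        exact Submodule.zero_mem _
    · rw [Submodule.span_le]
      rintro _ ⟨t, rfl⟩
      have : b t = S.col ⟨σ ((t : R) : Fin n), t.2⟩ := by
        ext i
        simp only [hScol, hb, Pi.single_apply]
        have hiff : i = (t : R) ↔ σ (i : Fin n) = σ ((t : R) : Fin n) := by
          rw [σ.injective.eq_iff, Subtype.ext_iff]
        by_cases hi : i = (t : R)
        · rw [if_pos hi, if_pos (hiff.1 hi)]
        · rw [if_neg hi, if_neg (fun h' => hi (hiff.2 h'))]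
      rw [this]
      exact Submodule.subset_span ⟨_, rfl⟩
  rw [Matrix.rank_eq_finrank_span_cols, hST, finrank_span_eq_card hli,
    Fintype.card_congr (Equiv.subtypeSubtypeEquivSubtypeInter P (fun i : Fin n => Q (σ i))),
    Fintype.card_subtype]

/-- **Corner ranks of a permutation matrix**: `ρ_{k,l}(P_σ) = #{i | k ≤ c i ∧ c' (σ i) ≤ l}`.
[folklore] -/
theorem cornerRank_permGL (σ : Equiv.Perm (Fin n)) (k : α) (l : β) :
    cornerRank c c' k l ((permGL σ : GL (Fin n) K) : Matrix (Fin n) (Fin n) K) =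
      (Finset.univ.filter fun i : Fin n => k ≤ c i ∧ c' (σ i) ≤ l).card := by
  classical
  rw [coe_permGL, cornerRank]
  convert rank_submatrix_permMatrix (K := K) σ (fun i => k ≤ c i) (fun j => c' j ≤ l) using 2

end Counts

section RowCounts

variable {n : ℕ} {α : Type*} [LinearOrder α] (c : Fin n → α)

/-! ### From cumulative corner counts to cell counts -/

/-- Rows strictly above a block label: `{i | a < c i}` is `{i | k₁ ≤ c i}` for the least value
`k₁` of `c` above `a`, or empty. Hence its counts against any column condition are determined
by the cumulative counts. [folklore] -/
theorem card_filter_lt_and_eq (a : α) (Q₁ Q₂ : Fin n → Prop) [DecidablePred Q₁] [DecidablePred Q₂]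
    (h : ∀ k : α, (Finset.univ.filter fun i : Fin n => k ≤ c i ∧ Q₁ i).card =
      (Finset.univ.filter fun i : Fin n => k ≤ c i ∧ Q₂ i).card) :
    (Finset.univ.filter fun i : Fin n => a < c i ∧ Q₁ i).card =
      (Finset.univ.filter fun i : Fin n => a < c i ∧ Q₂ i).card := by
  classical
  by_cases hex : ∃ i : Fin n, a < c i
  · set s : Finset α := (Finset.univ.filter fun i : Fin n => a < c i).image c with hs
    have hsne : s.Nonempty := by
      obtain ⟨i, hi⟩ := hex
      exact ⟨c i, Finset.mem_image.2 ⟨i, by simp [hi], rfl⟩⟩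
    set k₁ := s.min' hsne with hk₁
    have hk₁a : a < k₁ := by
      obtain ⟨i, hi, hik⟩ := Finset.mem_image.1 (s.min'_mem hsne)
      rw [← hk₁] at hik  -- no-op safeguard
      have : a < c i := by simpa using hi
      rw [hik] at this
      exact this
    have hiff : ∀ i : Fin n, a < c i ↔ k₁ ≤ c i := fun i =>
      ⟨fun hi => s.min'_le _ (Finset.mem_image.2 ⟨i, by simp [hi], rfl⟩),
        fun hi => lt_of_lt_of_le hk₁a hi⟩
    simp only [hiff]
    exact h k₁
  · push Not at hex
    have h1 : (Finset.univ.filter fun i : Fin n => a < c i ∧ Q₁ i) = ∅ :=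
      Finset.filter_eq_empty_iff.2 fun i _ hi => (not_lt.2 (hex i)) hi.1
    have h2 : (Finset.univ.filter fun i : Fin n => a < c i ∧ Q₂ i) = ∅ :=
      Finset.filter_eq_empty_iff.2 fun i _ hi => (not_lt.2 (hex i)) hi.1
    rw [h1, h2]

/-- Row differencing: counts on a single row block `{c = a}` from the cumulative ones.
[folklore] -/
theorem card_filter_eq_and_eq (a : α) (Q₁ Q₂ : Fin n → Prop) [DecidablePred Q₁] [DecidablePred Q₂]
    (h : ∀ k : α, (Finset.univ.filter fun i : Fin n => k ≤ c i ∧ Q₁ i).card =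
      (Finset.univ.filter fun i : Fin n => k ≤ c i ∧ Q₂ i).card) :
    (Finset.univ.filter fun i : Fin n => c i = a ∧ Q₁ i).card =
      (Finset.univ.filter fun i : Fin n => c i = a ∧ Q₂ i).card := by
  classical
  have hsplit : ∀ (Q : Fin n → Prop) [DecidablePred Q],
      (Finset.univ.filter fun i : Fin n => c i = a ∧ Q i).card =
        (Finset.univ.filter fun i : Fin n => a ≤ c i ∧ Q i).card -
          (Finset.univ.filter fun i : Fin n => a < c i ∧ Q i).card := by
    intro Q _
    have hsub : (Finset.univ.filter fun i : Fin n => a < c i ∧ Q i) ⊆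
        (Finset.univ.filter fun i : Fin n => a ≤ c i ∧ Q i) := by
      intro i hi
      simp only [Finset.mem_filter, Finset.mem_univ, true_and] at hi ⊢
      exact ⟨hi.1.le, hi.2⟩
    rw [← Finset.card_sdiff_of_subset hsub]
    congr 1
    ext i
    simp only [Finset.mem_sdiff, Finset.mem_filter, Finset.mem_univ, true_and, not_and]
    constructor
    · rintro ⟨hca, hQ⟩
      exact ⟨⟨hca.ge, hQ⟩, fun hlt => absurd hca hlt.ne'⟩
    · rintro ⟨⟨hle, hQ⟩, hnot⟩
      exact ⟨(eq_of_le_of_not_lt hle fun hlt => hnot hlt hQ).symm, hQ⟩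
  rw [hsplit Q₁, hsplit Q₂, h a, card_filter_lt_and_eq c a Q₁ Q₂ h]

end RowCounts

section Cells

variable {n : ℕ} {α β : Type*} [LinearOrder α] [LinearOrder β] (c : Fin n → α) (c' : Fin n → β)

/-- Column differencing, strict part: `{c' ∘ ρ < b}` is `{c' ∘ ρ ≤ l₁}` for the largest value
`l₁` of `c'` below `b` (or empty), uniformly in the permutation `ρ`. [folklore] -/
theorem card_filter_and_comp_lt_eq (R : Fin n → Prop) [DecidablePred R] (σ τ : Equiv.Perm (Fin n))
    (b : β)
    (h : ∀ l : β, (Finset.univ.filter fun i : Fin n => R i ∧ c' (τ i) ≤ l).card =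
      (Finset.univ.filter fun i : Fin n => R i ∧ c' (σ i) ≤ l).card) :
    (Finset.univ.filter fun i : Fin n => R i ∧ c' (τ i) < b).card =
      (Finset.univ.filter fun i : Fin n => R i ∧ c' (σ i) < b).card := by
  classical
  by_cases hex : ∃ j : Fin n, c' j < b
  · set s : Finset β := (Finset.univ.filter fun j : Fin n => c' j < b).image c' with hs
    have hsne : s.Nonempty := by
      obtain ⟨j, hj⟩ := hex
      exact ⟨c' j, Finset.mem_image.2 ⟨j, by simp [hj], rfl⟩⟩
    set l₁ := s.max' hsne with hl₁
    have hl₁b : l₁ < b := by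
      obtain ⟨j, hj, hjl⟩ := Finset.mem_image.1 (s.max'_mem hsne)
      have : c' j < b := by simpa using hj
      rw [hjl] at this
      exact this
    have hiff : ∀ (ρ : Equiv.Perm (Fin n)) (i : Fin n), c' (ρ i) < b ↔ c' (ρ i) ≤ l₁ := fun ρ i =>
      ⟨fun hi => s.le_max' _ (Finset.mem_image.2 ⟨ρ i, by simp [hi], rfl⟩),
        fun hi => lt_of_le_of_lt hi hl₁b⟩
    simp only [hiff]
    exact h l₁
  · push Not at hex
    have h1 : (Finset.univ.filter fun i : Fin n => R i ∧ c' (τ i) < b) = ∅ :=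
      Finset.filter_eq_empty_iff.2 fun i _ hi => (not_lt.2 (hex (τ i))) hi.2
    have h2 : (Finset.univ.filter fun i : Fin n => R i ∧ c' (σ i) < b) = ∅ :=
      Finset.filter_eq_empty_iff.2 fun i _ hi => (not_lt.2 (hex (σ i))) hi.2
    rw [h1, h2]

/-- Column differencing: counts on a single column block `{c' ∘ ρ = b}` from the cumulative ones.
[folklore] -/
theorem card_filter_and_comp_eq_eq (R : Fin n → Prop) [DecidablePred R] (σ τ : Equiv.Perm (Fin n))
    (b : β)
    (h : ∀ l : β, (Finset.univ.filter fun i : Fin n => R i ∧ c' (τ i) ≤ l).card =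
      (Finset.univ.filter fun i : Fin n => R i ∧ c' (σ i) ≤ l).card) :
    (Finset.univ.filter fun i : Fin n => R i ∧ c' (τ i) = b).card =
      (Finset.univ.filter fun i : Fin n => R i ∧ c' (σ i) = b).card := by
  classical
  have hsplit : ∀ ρ : Equiv.Perm (Fin n),
      (Finset.univ.filter fun i : Fin n => R i ∧ c' (ρ i) = b).card =
        (Finset.univ.filter fun i : Fin n => R i ∧ c' (ρ i) ≤ b).card -
          (Finset.univ.filter fun i : Fin n => R i ∧ c' (ρ i) < b).card := by
    intro ρ
    have hsub : (Finset.univ.filter fun i : Fin n => R i ∧ c' (ρ i) < b) ⊆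
        (Finset.univ.filter fun i : Fin n => R i ∧ c' (ρ i) ≤ b) := by
      intro i hi
      simp only [Finset.mem_filter, Finset.mem_univ, true_and] at hi ⊢
      exact ⟨hi.1, hi.2.le⟩
    rw [← Finset.card_sdiff_of_subset hsub]
    congr 1
    ext i
    simp only [Finset.mem_sdiff, Finset.mem_filter, Finset.mem_univ, true_and, not_and, not_lt]
    constructor
    · rintro ⟨hR, hcb⟩
      exact ⟨⟨hR, hcb.le⟩, fun _ => hcb.ge⟩
    · rintro ⟨⟨hR, hle⟩, hge⟩
      exact ⟨hR, le_antisymm hle (hge hR)⟩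
  rw [hsplit τ, hsplit σ, h b, card_filter_and_comp_lt_eq c' R σ τ b h]

/-- **Cell counts from corner counts** (double differencing): if the cumulative counts
`#{i | k ≤ c i ∧ c' (τ i) ≤ l}` and `#{i | k ≤ c i ∧ c' (σ i) ≤ l}` agree for all `k, l`, then so
do the cell counts `#{i | c i = a ∧ c' (τ i) = b}`, `#{i | c i = a ∧ c' (σ i) = b}` for all blocks
`(a, b)`. [folklore] -/
theorem cellCount_eq_of_cornerCount_eq {σ τ : Equiv.Perm (Fin n)}
    (h : ∀ (k : α) (l : β), (Finset.univ.filter fun i : Fin n => k ≤ c i ∧ c' (τ i) ≤ l).card =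
      (Finset.univ.filter fun i : Fin n => k ≤ c i ∧ c' (σ i) ≤ l).card) (a : α) (b : β) :
    (Finset.univ.filter fun i : Fin n => c i = a ∧ c' (τ i) = b).card =
      (Finset.univ.filter fun i : Fin n => c i = a ∧ c' (σ i) = b).card := by
  classical
  refine card_filter_and_comp_eq_eq c' (fun i => c i = a) σ τ b fun l => ?_
  exact card_filter_eq_and_eq c a (fun i => c' (τ i) ≤ l) (fun i => c' (σ i) ≤ l) (fun k => h k l)

/-! ### Permutations with equal cell counts differ by block-preserving permutations -/

/-- **Equal cell counts ⇒ same `(W_c, W_{c'})`-double class**: if `#{i | c i = a ∧ c' (τ i) = b} =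
#{i | c i = a ∧ c' (σ i) = b}` for all `(a, b)` then `τ = w' σ w` with `w` preserving the blocks
of `c` and `w'` those of `c'` (Bernstein–Zelevinsky 1977, Lemma 2.11, for `GL_n`; built with
`Equiv.ofFiberEquiv` on the fibres of `i ↦ (c i, c' (σ i))`).
[cite: BernsteinZelevinsky1977, Lemma 2.11] -/
theorem exists_perm_eq_of_cellCount_eq {σ τ : Equiv.Perm (Fin n)}
    (h : ∀ (a : α) (b : β), (Finset.univ.filter fun i : Fin n => c i = a ∧ c' (τ i) = b).card =
      (Finset.univ.filter fun i : Fin n => c i = a ∧ c' (σ i) = b).card) :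
    ∃ w w' : Equiv.Perm (Fin n), (∀ i, c (w i) = c i) ∧ (∀ j, c' (w' j) = c' j) ∧
      τ = w' * σ * w := by
  classical
  let f : Fin n → α × β := fun i => (c i, c' (τ i))
  let g : Fin n → α × β := fun i => (c i, c' (σ i))
  have hcard : ∀ p : α × β, Fintype.card {i // f i = p} = Fintype.card {i // g i = p} := by
    intro p
    rw [Fintype.card_subtype, Fintype.card_subtype]
    have hf : (Finset.univ.filter fun i => f i = p) =
        Finset.univ.filter fun i : Fin n => c i = p.1 ∧ c' (τ i) = p.2 := by
      ext i; simp [f, Prod.ext_iff]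
    have hg : (Finset.univ.filter fun i => g i = p) =
        Finset.univ.filter fun i : Fin n => c i = p.1 ∧ c' (σ i) = p.2 := by
      ext i; simp [g, Prod.ext_iff]
    rw [hf, hg]
    exact h p.1 p.2
  let e : ∀ p : α × β, {i // f i = p} ≃ {i // g i = p} := fun p => Fintype.equivOfCardEq (hcard p)
  let w : Equiv.Perm (Fin n) := Equiv.ofFiberEquiv e
  have hw : ∀ i, g (w i) = f i := fun i => Equiv.ofFiberEquiv_map e i
  have hwc : ∀ i, c (w i) = c i := fun i => (Prod.ext_iff.1 (hw i)).1
  have hwc' : ∀ i, c' (σ (w i)) = c' (τ i) := fun i => (Prod.ext_iff.1 (hw i)).2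
  refine ⟨w, τ * (σ * w)⁻¹, hwc, fun j => ?_, by group⟩
  have hj : (τ * (σ * w)⁻¹) j = τ (w⁻¹ (σ⁻¹ j)) := by
    simp [Equiv.Perm.mul_apply, Equiv.Perm.inv_def]
  rw [hj, ← hwc' (w⁻¹ (σ⁻¹ j))]
  simp

end Cells

/-! ### The double cosets -/

section DoubleCoset

variable {K : Type*} [Field K] {n : ℕ} {α β : Type*} [LinearOrder α] [LinearOrder β]
  (c : Fin n → α) (c' : Fin n → β)

/-- The **`(P_c, P_{c'})`-double coset** `P_c x P_{c'} = {p x q : p ∈ P_c, q ∈ P_{c'}}` of `x`.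
(Bernstein–Zelevinsky 1977, 1.5; Casselman 1995, §6.3, `C(w)`.) [folklore] -/
def doubleCoset (x : GL (Fin n) K) : Set (GL (Fin n) K) :=
  {g | ∃ p ∈ standardParabolicGL K c, ∃ q ∈ standardParabolicGL K c', g = p * x * q}

/-- `x ∈ P_c x P_{c'}`. [folklore] -/
theorem mem_doubleCoset_self (x : GL (Fin n) K) : x ∈ doubleCoset c c' x :=
  ⟨1, Subgroup.one_mem _, 1, Subgroup.one_mem _, by rw [one_mul, mul_one]⟩

/-- `P_c (P_c x P_{c'}) P_{c'} = P_c x P_{c'}`. [folklore] -/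
theorem mul_mul_mem_doubleCoset {x g : GL (Fin n) K} (hg : g ∈ doubleCoset c c' x)
    {p q : GL (Fin n) K} (hp : p ∈ standardParabolicGL K c) (hq : q ∈ standardParabolicGL K c') :
    p * g * q ∈ doubleCoset c c' x := by
  obtain ⟨p', hp', q', hq', rfl⟩ := hg
  exact ⟨p * p', Subgroup.mul_mem _ hp hp', q' * q, Subgroup.mul_mem _ hq' hq, by group⟩

/-- Double cosets containing a common... : if `y ∈ P_c x P_{c'}` then `P_c y P_{c'} ⊆ P_c x P_{c'}`.
[folklore] -/
theorem doubleCoset_subset_of_mem {x y : GL (Fin n) K} (hy : y ∈ doubleCoset c c' x) :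
    doubleCoset c c' y ⊆ doubleCoset c c' x := by
  rintro g ⟨p, hp, q, hq, rfl⟩
  exact mul_mul_mem_doubleCoset c c' hy hp hq

/-- Membership is symmetric: `y ∈ P_c x P_{c'} → x ∈ P_c y P_{c'}`. [folklore] -/
theorem mem_doubleCoset_symm {x y : GL (Fin n) K} (hy : y ∈ doubleCoset c c' x) :
    x ∈ doubleCoset c c' y := by
  obtain ⟨p, hp, q, hq, rfl⟩ := hy
  exact ⟨p⁻¹, Subgroup.inv_mem _ hp, q⁻¹, Subgroup.inv_mem _ hq, by group⟩

/-- Corner ranks are constant on double cosets. [folklore] -/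
theorem cornerRank_eq_of_mem_doubleCoset {x g : GL (Fin n) K} (hg : g ∈ doubleCoset c c' x)
    (k : α) (l : β) :
    cornerRank c c' k l (g : Matrix (Fin n) (Fin n) K) =
      cornerRank c c' k l (x : Matrix (Fin n) (Fin n) K) := by
  obtain ⟨p, hp, q, hq, rfl⟩ := hg
  rw [Units.val_mul, Units.val_mul, cornerRank_mul_parabolic c c' hq,
    cornerRank_parabolic_mul c c' hp]

/-- **Permutation matrices with equal corner ranks lie in the same double coset.** [folklore] -/
theorem permGL_mem_doubleCoset_permGL_of_cornerRank_eq {σ τ : Equiv.Perm (Fin n)}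
    (h : ∀ (k : α) (l : β),
      cornerRank c c' k l ((permGL τ : GL (Fin n) K) : Matrix (Fin n) (Fin n) K) =
        cornerRank c c' k l ((permGL σ : GL (Fin n) K) : Matrix (Fin n) (Fin n) K)) :
    (permGL τ : GL (Fin n) K) ∈ doubleCoset c c' (permGL σ) := by
  classical
  have hcount : ∀ (k : α) (l : β),
      (Finset.univ.filter fun i : Fin n => k ≤ c i ∧ c' (τ i) ≤ l).card =
        (Finset.univ.filter fun i : Fin n => k ≤ c i ∧ c' (σ i) ≤ l).card := fun k l => by
    have := h k l
    rwa [cornerRank_permGL, cornerRank_permGL] at this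
  obtain ⟨w, w', hw, hw', rfl⟩ :=
    exists_perm_eq_of_cellCount_eq c c' (cellCount_eq_of_cornerCount_eq c c' hcount)
  refine ⟨permGL w, permGL_mem_standardParabolicGL c fun i => (hw i).ge, permGL w',
    permGL_mem_standardParabolicGL c' fun j => (hw' j).ge, ?_⟩
  rw [permGL_mul_permGL, permGL_mul_permGL, ← mul_assoc]

/-- **Every double coset contains a permutation matrix** (Bruhat decomposition,
`exists_eq_parabolic_mul_permGL_mul_upperUnitriangular`, and `U ≤ P_{c'}`). [folklore] -/
theorem exists_mem_doubleCoset_permGL (hc : Monotone c) (hc' : Monotone c') (g : GL (Fin n) K) :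
    ∃ σ : Equiv.Perm (Fin n), g ∈ doubleCoset c c' (permGL σ) := by
  obtain ⟨p, σ, u, hp, rfl⟩ := exists_eq_parabolic_mul_permGL_mul_upperUnitriangular hc g
  have hu : (u : GL (Fin n) K) ∈ standardParabolicGL K c' :=
    borel_le_standardParabolicGL (R := K) hc'
      (unipotentRadicalGL_le K (_root_.id : Fin n → Fin n) u.2)
  exact ⟨σ, p, hp, u, hu, rfl⟩

/-- **The double coset of a permutation matrix is a fibre of the corner-rank vector.**
(Bernstein–Zelevinsky 1977, 1.5 / Lemma 2.11: `P \ G / Q ↔ W_M \ W / W_N`, for `GL_n` in the form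
"equal corner ranks ⇔ same double coset".) [cite: BernsteinZelevinsky1977, Lemma 2.11] -/
theorem doubleCoset_permGL_eq_setOf_cornerRank_eq (hc : Monotone c) (hc' : Monotone c')
    (σ : Equiv.Perm (Fin n)) :
    doubleCoset c c' (permGL σ : GL (Fin n) K) =
      {g : GL (Fin n) K | ∀ kl : α × β, cornerRank c c' kl.1 kl.2 (g : Matrix (Fin n) (Fin n) K) =
        cornerRank c c' kl.1 kl.2 ((permGL σ : GL (Fin n) K) : Matrix (Fin n) (Fin n) K)} := by
  ext g
  constructor
  · exact fun hg kl => cornerRank_eq_of_mem_doubleCoset c c' hg kl.1 kl.2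
  · intro hg
    obtain ⟨τ, hτ⟩ := exists_mem_doubleCoset_permGL c c' hc hc' g
    have hτσ : (permGL τ : GL (Fin n) K) ∈ doubleCoset c c' (permGL σ) :=
      permGL_mem_doubleCoset_permGL_of_cornerRank_eq c c' fun k l => by
        rw [← cornerRank_eq_of_mem_doubleCoset c c' hτ k l]
        exact hg (k, l)
    exact doubleCoset_subset_of_mem c c' hτσ hτ

/-- **Two double cosets coincide as soon as they meet** (they are the fibres of the corner-rank
vector): in particular the `(P_c, P_{c'})`-double cosets partition `GL_n(K)`. [folklore] -/
theorem doubleCoset_eq_of_mem (hc : Monotone c) (hc' : Monotone c') {x g : GL (Fin n) K}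
    (hg : g ∈ doubleCoset c c' x) : doubleCoset c c' g = doubleCoset c c' x := by
  obtain ⟨σ, hσ⟩ := exists_mem_doubleCoset_permGL c c' hc hc' x
  have hx : doubleCoset c c' x = doubleCoset c c' (permGL σ : GL (Fin n) K) :=
    Set.Subset.antisymm (doubleCoset_subset_of_mem c c' hσ)
      (doubleCoset_subset_of_mem c c' (mem_doubleCoset_symm c c' hσ))
  have hg' : g ∈ doubleCoset c c' (permGL σ : GL (Fin n) K) := hx ▸ hg
  rw [hx]
  exact Set.Subset.antisymm (doubleCoset_subset_of_mem c c' hg')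
    (doubleCoset_subset_of_mem c c' (mem_doubleCoset_symm c c' hg'))

/-- Two double cosets are equal or disjoint. [folklore] -/
theorem doubleCoset_eq_or_disjoint (hc : Monotone c) (hc' : Monotone c') (x y : GL (Fin n) K) :
    doubleCoset c c' x = doubleCoset c c' y ∨
      Disjoint (doubleCoset c c' x) (doubleCoset c c' y) := by
  by_cases h : Disjoint (doubleCoset c c' x) (doubleCoset c c' y)
  · exact Or.inr h
  · left
    obtain ⟨g, hgx, hgy⟩ := Set.not_disjoint_iff.1 h
    rw [← doubleCoset_eq_of_mem c c' hc hc' hgx, doubleCoset_eq_of_mem c c' hc hc' hgy]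

/-- **Finitely many double cosets**: every `P_c x P_{c'}` is the double coset of one of the `n!`
permutation matrices. [cite: BernsteinZelevinsky1977, Lemma 2.11] -/
theorem finite_setOf_doubleCoset (hc : Monotone c) (hc' : Monotone c') :
    {D : Set (GL (Fin n) K) | ∃ x, D = doubleCoset c c' x}.Finite := by
  refine (Set.finite_range fun σ : Equiv.Perm (Fin n) =>
    doubleCoset c c' (permGL σ : GL (Fin n) K)).subset ?_
  rintro _ ⟨x, rfl⟩
  obtain ⟨σ, hσ⟩ := exists_mem_doubleCoset_permGL c c' hc hc' x
  exact ⟨σ, (doubleCoset_eq_of_mem c c' hc hc' hσ).symm ▸ rfl⟩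

variable [Fintype α] [Fintype β]

/-- The total corner rank is constant on double cosets. [folklore] -/
theorem totalCornerRank_eq_of_mem_doubleCoset {x g : GL (Fin n) K} (hg : g ∈ doubleCoset c c' x) :
    totalCornerRank c c' (g : Matrix (Fin n) (Fin n) K) =
      totalCornerRank c c' (x : Matrix (Fin n) (Fin n) K) :=
  Finset.sum_congr rfl fun kl _ => cornerRank_eq_of_mem_doubleCoset c c' hg kl.1 kl.2

/-- A double coset as a fibre of the corner-rank vector of one of its permutation matrices, with
the value of the total corner rank. [folklore] -/
theorem exists_perm_doubleCoset_eq_fibre (hc : Monotone c) (hc' : Monotone c') (x : GL (Fin n) K) :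
    ∃ σ : Equiv.Perm (Fin n),
      doubleCoset c c' x = {g : GL (Fin n) K | ∀ kl : α × β,
        cornerRank c c' kl.1 kl.2 (g : Matrix (Fin n) (Fin n) K) =
          cornerRank c c' kl.1 kl.2 ((permGL σ : GL (Fin n) K) : Matrix (Fin n) (Fin n) K)} ∧
      totalCornerRank c c' (x : Matrix (Fin n) (Fin n) K) =
        ∑ kl : α × β,
          cornerRank c c' kl.1 kl.2 ((permGL σ : GL (Fin n) K) : Matrix (Fin n) (Fin n) K) := by
  obtain ⟨σ, hσ⟩ := exists_mem_doubleCoset_permGL c c' hc hc' x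
  refine ⟨σ, ?_, totalCornerRank_eq_of_mem_doubleCoset c c' hσ⟩
  rw [← doubleCoset_permGL_eq_setOf_cornerRank_eq c c' hc hc' σ]
  exact (doubleCoset_eq_of_mem c c' hc hc' (mem_doubleCoset_symm c c' hσ)).symm

variable [TopologicalSpace K] [IsTopologicalRing K] [T1Space K]

/-- **A double coset is relatively open in its level set of the total corner rank**
(Casselman 1995, §6.3: `C(x)` is open in `G_R ∖ G_{R'}` for `x` minimal).
[cite: Casselman1995, §6.3, p. 55] -/
theorem exists_isOpen_doubleCoset_eq_inter (hc : Monotone c) (hc' : Monotone c')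
    (x : GL (Fin n) K) :
    ∃ U : Set (GL (Fin n) K), IsOpen U ∧ doubleCoset c c' x =
      U ∩ {g : GL (Fin n) K | totalCornerRank c c' (g : Matrix (Fin n) (Fin n) K) =
        totalCornerRank c c' (x : Matrix (Fin n) (Fin n) K)} := by
  obtain ⟨σ, hD, htot⟩ := exists_perm_doubleCoset_eq_fibre c c' hc hc' x
  obtain ⟨U, hU, hfib⟩ := exists_isOpen_cornerRankFibre_eq_inter (K := K) c c'
    (fun kl : α × β =>
      cornerRank c c' kl.1 kl.2 ((permGL σ : GL (Fin n) K) : Matrix (Fin n) (Fin n) K))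
  refine ⟨U, hU, ?_⟩
  rw [hD, hfib, htot]

/-- **A double coset is relatively closed in its level set of the total corner rank**
(Casselman 1995, §6.3: "the intersection of `G_R` with the closure of `C(x)` … is `C(x)` itself,
which is therefore closed in `G_R`"). [cite: Casselman1995, §6.3, p. 55] -/
theorem exists_isClosed_doubleCoset_eq_inter (hc : Monotone c) (hc' : Monotone c')
    (x : GL (Fin n) K) :
    ∃ Z : Set (GL (Fin n) K), IsClosed Z ∧ doubleCoset c c' x =
      Z ∩ {g : GL (Fin n) K | totalCornerRank c c' (g : Matrix (Fin n) (Fin n) K) =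
        totalCornerRank c c' (x : Matrix (Fin n) (Fin n) K)} := by
  obtain ⟨σ, hD, htot⟩ := exists_perm_doubleCoset_eq_fibre c c' hc hc' x
  obtain ⟨Z, hZ, hfib⟩ := exists_isClosed_cornerRankFibre_eq_inter (K := K) c c'
    (fun kl : α × β =>
      cornerRank c c' kl.1 kl.2 ((permGL σ : GL (Fin n) K) : Matrix (Fin n) (Fin n) K))
  refine ⟨Z, hZ, ?_⟩
  rw [hD, hfib, htot]

omit [TopologicalSpace K] [IsTopologicalRing K] [T1Space K] in
/-- **The open filtration is bi-invariant**: `{g | m ≤ |ρ|(g)}` is a union of double cosets.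
[folklore] -/
theorem doubleCoset_subset_setOf_le_totalCornerRank {m : ℕ} {x : GL (Fin n) K}
    (hx : m ≤ totalCornerRank c c' (x : Matrix (Fin n) (Fin n) K)) :
    doubleCoset c c' x ⊆
      {g : GL (Fin n) K | m ≤ totalCornerRank c c' (g : Matrix (Fin n) (Fin n) K)} := fun g hg => by
  change m ≤ totalCornerRank c c' (g : Matrix (Fin n) (Fin n) K)
  rw [totalCornerRank_eq_of_mem_doubleCoset c c' hg]
  exact hx

end DoubleCoset

end Literature.NumberTheory.Automorphic
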